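import Mathlib
import HarnessLib
import Summits.Ventures.LatticeQCDFlow.Scaling.GeneralLayerLagLawUniform
import Summits.Ventures.LatticeQCDFlow.Scaling.ProtocolReverseChain

/-!
# GeneralLayerESSCeiling — the non-equilibrium PATH ESS of the uniform switching protocol with
# ARBITRARY relaxation layers cannot beat the quasi-static ceiling by more than the lag budget:
# `ÊSS ≤ exp(−[(⟨D⟩_0 − ⟨D⟩_1)/(2n) − (θ/(1−θ))·σ̄²/n − M₃/(12n²)])`

HONEST FRAMING: exact (Metropolis-corrected) sampling algorithms for lattice gauge theory;
figures of merit are autocorrelation/cost numbers at stated couplings and volumes; no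
continuum-physics claim.

Venture `LatticeQCDFlow` (cell pub-lqcd), topic `Scaling`; FANOUT row 19 (`su2-snf`, GEN-5).
OUR WORK (elementary finite sums), nothing cited as a fact.  Row 8 certified the ESS CEILING of the
uniform switching protocol `S_c = S₀ + c•D`, `c_j = j/n`, for PERFECT and LAZY relaxation
(`QuasiStaticFloorLaw.ess_perfect_uniform_le_exp`, `LazyRelaxationESS.ess_lazy_uniform_le_exp`:
`ÊSS ≤ exp(−(⟨D⟩_0 − ⟨D⟩_1)/(2n) + M/(12n²))`, lazy layers being monotone), "the production
heat-bath / over-relaxation kernels not claimed".  This file bounds the path ESS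
(`essFrac (revPathLaw S P) (pathLaw (gibbsLaw (S 0)) P)`, theory-2's `ÊSS = (E e^{−W})²/E e^{−2W}`,
`StochasticBudgets.essFrac_path_eq`) for EVERY family of positive layers leaving the Boltzmann
weights invariant, the only datum being the SAME `χ²`-contraction coefficient `ρ` of the layers as
in the mean-work law (`Scaling/ChiSqContraction`; the reversals inherit it,
`ProtocolReverseChain.chiSqContracts_timeReversal`, through the bridge to the Literature's `L²₀(π)`
operator norm and Liu's duality; `ρ = λ⋆` for reversible irreducible layers):

* reverse-chain bookkeeping is `Scaling/ProtocolReverseChain` (`revIdx`, the backward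
  marginalisation `sum_revChain_mul_apply`, `klFin_rev_eq`: `D(P_R ‖ P_F) = ΔF − E_R[W]`);
* `revGrid n` — the reversed uniform grid read forward (`1, 1, (n−1)/n, …, 1/n, 0`), its steps
  `≤ 1/n` (`abs_revGrid_succ_sub_le`);
* **`ess_path_uniform_le_exp` — THE ESS CEILING FOR ARBITRARY LAYERS**: if `|D x − D y| ≤ ΔD`,
  `Var_c(D) ≤ σ̄²`, `|κ₃,c(D)| ≤ M₃` on `[0,1]`, and the layers `χ²`-contract towards their
  targets with `ρ ≥ 0`, `θ = ρ·e^{ΔD/(2n)} < 1`, then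
  `ÊSS ≤ exp(−[(⟨D⟩_0 − ⟨D⟩_1)/(2n) − (θ/(1−θ))σ̄²/n − M₃/(12n²)])`.
  MECHANISM: `−log ÊSS ≥ D(P_R ‖ P_F)` (theory-2's `essFrac_le_exp_neg_kl` on path space)
  `= ΔF − E_R[W] = KL_qs^R − lag^R`, where the REVERSE quasi-static cost is
  `KL_qs^R = (⟨D⟩_0 − ⟨D⟩_1)/n − KL_qs ≥ (⟨D⟩_0 − ⟨D⟩_1)/(2n) − M₃/(12n²)` (row 8's floor) and
  the reverse lag is controlled by the general-layer lag law RUN BACKWARDS — the marginals of the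
  reverse path law are a forward `evolveLaw` of the re-indexed reversals along `revGrid`, so
  `GeneralLayerLagLaw.sqrt_chiSqDiv_evolveLaw_le_lagSeq` and
  `GeneralLayerLagLawUniform.lagSeq_const_le_geom` give `|lag^R| ≤ (θ/(1−θ))σ̄²/n`;
* `ess_path_uniform_le_exp_of_reversible` — the instance for positive stochastic layers in
  detailed balance with their targets and irreducible, `ρ = max_k λ⋆(P_k)`: NO laziness,
  monotonicity or positive-correlation hypothesis.

Reading (value-free): no relaxation scheme whatsoever — under-, over- or anti-correlated — pushes
the NE/Jarzynski path ESS above the quasi-static ceiling `e^{−(⟨D⟩_0 − ⟨D⟩_1)/(2n)}` by more than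
the factor `exp((θ/(1−θ))σ̄²/n + M₃/(12n²))`; for fast layers (`θ → 0`) the ceiling is row 8's.
NOT CLAIMED: the matching FLOOR on ÊSS (needs exponential moments of `W`; only the Gaussian /
AR(1) dictionary `−log ESS = Var W` gives it, `Scaling/AR1SwitchingJarzynski`); any value of `ρ`,
`σ̄`, `M₃` for a lattice kernel; non-positive layers (the path-space `χ²`/KL step needs `P > 0`).
Layer families are indexed by every `k : ℕ` (extend a finite family by any positive
Boltzmann-invariant layer, e.g. perfect relaxation onto the next Gibbs law).
Informativeness: the ceiling is `< 1` only for well-relaxed layers (`(θ/(1−θ))σ̄² < (⟨D⟩_0 −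
⟨D⟩_1)/2`); on the 3-state Metropolis toy of `GeneralLayerLagLawUniform`'s note with 4 sweeps per
step (`ρ ≈ 0.06`), `n = 128`: exact `ÊSS = 0.987` ≤ `0.995` (this file) vs `0.994` (quasi-static).
-/

namespace Summit.Ventures.LatticeQCDFlow.Scaling

open Finset
open Literature.Probability.MarkovChains (IsRowStochastic IsStationary stepLaw DetailedBalance
  IsIrreducible lambdaStar lawVariance lawMean lambdaStar_nonneg stepLaw_nonneg)
open Literature.Probability.ImportanceSampling (chiSqDiv chiSqDiv_def chiSqDiv_eq_sum_sq_div)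
open Summit.Ventures.LatticeQCDFlow.Exactness
open Summit.Ventures.LatticeQCDFlow.Theory2

variable {X : Type*} [Fintype X]

/-! ## The ESS ceiling for arbitrary layers along the uniform protocol -/

section Ceiling

variable [Nonempty X]

/-- The reversed reference grid read forward from the end: `c''_0 = 1`, `c''_i = (n+1−i)/n`
(`1 ≤ i ≤ n+1`), `0` beyond — as `((n − (i − 1)) : ℕ)/n` with truncated subtraction. -/
noncomputable def revGrid (n : ℕ) (i : ℕ) : ℝ := ((n - (i - 1) : ℕ) : ℝ) / n

/-- `revGrid n 0 = n/n`. -/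
theorem revGrid_zero (n : ℕ) : revGrid n 0 = (n : ℝ) / n := by simp [revGrid]

/-- Consecutive points of `revGrid n` are at most `1/n` apart. -/
theorem abs_revGrid_succ_sub_le {n : ℕ} (hn : n ≠ 0) (i : ℕ) :
    |revGrid n (i + 1) - revGrid n i| ≤ 1 / n := by
  have hn' : (0 : ℝ) < n := Nat.cast_pos.mpr (Nat.pos_of_ne_zero hn)
  unfold revGrid
  rw [← sub_div, abs_div, abs_of_pos hn']
  refine div_le_div_of_nonneg_right ?_ hn'.le
  rw [show (i + 1 - 1 : ℕ) = i by omega]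
  rcases Nat.eq_zero_or_pos i with rfl | hi
  · simp
  · rw [show (i - 1 : ℕ) = i - 1 from rfl]
    have : (n - (i - 1) : ℕ) = (n - i : ℕ) + (if i ≤ n then 1 else 0) := by
      split_ifs with h <;> omega
    rw [this]
    push_cast
    split_ifs <;> simp

/-- **THE ESS CEILING FOR ARBITRARY LAYERS (uniform grid).**  Positive layers `P k` with unit
row sums leaving each Boltzmann weight `e^{−S_{(k+1)/n}}` invariant and contracting `χ²` towards
`π_{(k+1)/n}` with coefficient `ρ ≥ 0` (the hypothesis of the mean-work law; `ρ = λ⋆` for reversible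
irreducible layers; their reversals then contract with the same `ρ`, `chiSqContracts_timeReversal`),
`|D x − D y| ≤ ΔD`, `Var_c(D) ≤ σ̄²`,
`θ = ρ·e^{ΔD/(2n)} < 1`, `|κ₃,c(D)| ≤ M₃` on `[0,1]`: the non-equilibrium PATH ESS obeys
`ÊSS ≤ exp(−[(⟨D⟩_0 − ⟨D⟩_1)/(2n) − (θ/(1−θ))·σ̄²/n − M₃/(12n²)])` —
row 8's certified ceiling `exp(−floor + M₃/(12n²))` (perfect / lazy layers) holds for EVERY such
layer family up to the lag budget `(θ/(1−θ))σ̄²/n`: no relaxation scheme beats the quasi-static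
ESS ceiling by more than that factor. -/
theorem ess_path_uniform_le_exp (S₀ D : X → ℝ) (P : ℕ → X → X → ℝ) {n : ℕ} (hn : n ≠ 0)
    {ΔD ρ σbar M₃ : ℝ} (hD : ∀ x y, |D x - D y| ≤ ΔD)
    (hPpos : ∀ k x y, 0 < P k x y)
    (hst : ∀ k, IsStationary
      (fun x => Real.exp (-(linAction S₀ D (((k + 1 : ℕ) : ℝ) / n) x))) (P k))
    (hProw : ∀ k x, ∑ y, P k x y = 1)
    (hK : ∀ k, ChiSqContracts (P k) (gibbsLaw (linAction S₀ D (((k + 1 : ℕ) : ℝ) / n))) ρ)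
    (hρ : 0 ≤ ρ) (hσ0 : 0 ≤ σbar) (hσ : ∀ c, varD S₀ D c ≤ σbar ^ 2)
    (hθ1 : ρ * Real.exp (ΔD / (2 * n)) < 1)
    (hM : ∀ c ∈ Set.Icc (0:ℝ) 1, |kappa3D S₀ D c| ≤ M₃) :
    essFrac (revPathLaw (fun k : Fin (n + 1) => linAction S₀ D ((k : ℝ) / n)) (fun k : Fin n => P k))
        (pathLaw (gibbsLaw (linAction S₀ D (((0 : Fin (n + 1)) : ℝ) / n))) (fun k : Fin n => P k))
      ≤ Real.exp (-((meanD S₀ D 0 - meanD S₀ D 1) / (2 * n)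
          - (ρ * Real.exp (ΔD / (2 * n))) / (1 - ρ * Real.exp (ΔD / (2 * n))) * (σbar ^ 2 / n)
          - M₃ / (12 * (n : ℝ) ^ 2))) := by
  -- the reversals contract χ² towards their targets because the (stationary) layers
  -- χ²-contract with the same coefficient: `chiSqContracts_timeReversal`
  have hKrev : ∀ k, ChiSqContracts
      (revKernel (fun x => Real.exp (-(linAction S₀ D (((k + 1 : ℕ) : ℝ) / n) x))) (P k))
      (gibbsLaw (linAction S₀ D (((k + 1 : ℕ) : ℝ) / n))) ρ := by
    intro k
    rw [revKernel_exp_eq_timeReversal]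
    exact chiSqContracts_timeReversal (gibbsLaw_pos _) (sum_gibbsLaw _) (hProw k)
      (isStationary_gibbsLaw_of_exp (hst k)) hρ (hK k)
  -- notation
  set θ := ρ * Real.exp (ΔD / (2 * n)) with hθdef
  set S : Fin (n + 1) → X → ℝ := fun k => linAction S₀ D ((k : ℝ) / n) with hS
  set P' : Fin n → X → X → ℝ := fun k => P k with hP'
  set R : Fin n → X → X → ℝ := fun k => revKernel (fun x => Real.exp (-(S k.succ x))) (P' k)
    with hR
  set J : X → X → ℝ := fun _ y => gibbsLaw (linAction S₀ D 0) y with hJ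
  set Q := revIdx R J with hQ
  have hθ0 : 0 ≤ θ := by positivity
  have h1θ : 0 < 1 - θ := sub_pos.mpr hθ1
  have hn' : (0 : ℝ) < n := Nat.cast_pos.mpr (Nat.pos_of_ne_zero hn)
  have hΔD0 : 0 ≤ ΔD := (abs_nonneg _).trans (hD (Classical.arbitrary X) (Classical.arbitrary X))
  -- the layers seen by the `Fin`-indexed protocol
  have hS_succ : ∀ k : Fin n, S k.succ = linAction S₀ D ((((k : ℕ) + 1 : ℕ) : ℝ) / n) := by
    intro k; simp [hS, Fin.val_succ]
  have hst' : ∀ k : Fin n, IsStationary (fun x => Real.exp (-(S k.succ x))) (P' k) := by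
    intro k; rw [hS_succ k]; exact hst k
  have hPpos' : ∀ (k : Fin n) x y, 0 < P' k x y := fun k => hPpos k
  -- the backward kernels, re-indexed from the end, and their properties
  have hRrow : ∀ (k : Fin n) y, ∑ x, R k y x = 1 := fun k y =>
    revKernel_rowsum (fun _ => Real.exp_pos _) (hst' k) y
  have hQrow : ∀ i x, ∑ y, Q i x y = 1 := by
    intro i x
    by_cases hi : i < n
    · rw [hQ, revIdx_of_lt R J hi]; exact hRrow _ x
    · rw [hQ, revIdx_of_le R J (not_lt.mp hi), hJ]; exact sum_gibbsLaw _
  have hQK : ∀ i, ChiSqContracts (Q i) (gibbsLaw (linAction S₀ D (revGrid n (i + 1)))) ρ := by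
    intro i
    unfold revGrid
    rw [show (i + 1 - 1 : ℕ) = i by omega]
    by_cases hi : i < n
    · have e1 : Q i = revKernel
          (fun x => Real.exp (-(linAction S₀ D ((((n - 1 - i) + 1 : ℕ) : ℝ) / n) x)))
          (P (n - 1 - i)) := by
        rw [hQ, revIdx_of_lt R J hi, hR]
        simp only [hS_succ, hP']
      rw [e1, show (n - i : ℕ) = n - 1 - i + 1 by omega]
      exact hKrev (n - 1 - i)
    · rw [hQ, revIdx_of_le R J (not_lt.mp hi), hJ, Nat.sub_eq_zero_of_le (not_lt.mp hi)]
      simp only [Nat.cast_zero, zero_div]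
      exact (chiSqContracts_perfect _).mono (fun y => (gibbsLaw_pos _ y).le) le_rfl hρ
  have hQθ : ∀ k, ρ * Real.exp (|revGrid n (k + 1) - revGrid n k| * ΔD / 2) ≤ θ := by
    intro k
    refine mul_le_mul_of_nonneg_left (Real.exp_le_exp.mpr ?_) hρ
    have h := abs_revGrid_succ_sub_le hn k
    calc |revGrid n (k + 1) - revGrid n k| * ΔD / 2 ≤ 1 / n * ΔD / 2 := by
          gcongr
      _ = ΔD / (2 * n) := by field_simp
  -- B1's χ² recursion for the backward chain, then B2's saturation
  have hstart : gibbsLaw (linAction S₀ D (revGrid n 0)) = gibbsLaw (S (Fin.last n)) := by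
    rw [revGrid_zero, hS]; simp [Fin.val_last]
  have hchi : ∀ j, Real.sqrt (chiSqDiv (evolveLaw Q (gibbsLaw (S (Fin.last n))) j)
        (gibbsLaw (linAction S₀ D (revGrid n j)))) ≤ θ / (1 - θ) * (σbar / n) := by
    intro j
    have h := sqrt_chiSqDiv_evolveLaw_le_lagSeq S₀ D (revGrid n) Q hQrow hD hQK hρ hQθ j
    rw [hstart] at h
    have hsq : ∀ c, Real.sqrt (varD S₀ D c) ≤ σbar := fun c =>
      (Real.sqrt_le_sqrt (hσ c)).trans_eq (Real.sqrt_sq hσ0)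
    have hd : ∀ k, |revGrid n (k + 1) - revGrid n k| * Real.sqrt (varD S₀ D (revGrid n k))
        ≤ σbar / n := by
      intro k
      calc |revGrid n (k + 1) - revGrid n k| * Real.sqrt (varD S₀ D (revGrid n k))
          ≤ 1 / n * σbar := mul_le_mul (abs_revGrid_succ_sub_le hn k) (hsq _)
            (Real.sqrt_nonneg _) (by positivity)
        _ = σbar / n := by ring
    exact h.trans ((lagSeq_le_lagSeq_of_le hθ0 hd j).trans
      (lagSeq_const_le_geom hθ0 hθ1 (by positivity) j))
  -- the reverse mean work, step by step
  have hEW : ∑ ω, revPathLaw S P' ω * work S ω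
      = ∑ k ∈ range n, (1 / (n : ℝ)) * ∑ x, evolveLaw Q (gibbsLaw (S (Fin.last n))) (n - k) x * D x := by
    have hwork : ∀ ω : Fin (n + 1) → X, work S ω
        = ∑ k : Fin n, (1 / (n : ℝ)) * D (ω k.castSucc) := by
      intro ω
      unfold work
      refine sum_congr rfl fun k _ => ?_
      simp only [hS, Fin.val_succ, Fin.val_castSucc, linAction]
      rw [show (((k : ℕ) + 1 : ℕ) : ℝ) = (k : ℝ) + 1 by push_cast; ring]
      field_simp
      ring
    simp_rw [hwork, mul_sum]
    rw [sum_comm, ← Fin.sum_univ_eq_sum_range]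
    refine sum_congr rfl fun k _ => ?_
    have hE1 := sum_revChain_mul_apply J n R hRrow (gibbsLaw (S (Fin.last n))) k.castSucc D
    simp only [Fin.val_castSucc] at hE1
    rw [← hQ] at hE1
    have hE1' : ∑ ω, revPathLaw S P' ω * D (ω k.castSucc)
        = ∑ x, evolveLaw Q (gibbsLaw (S (Fin.last n))) (n - k) x * D x := by
      rw [← hE1]
      refine sum_congr rfl fun ω _ => ?_
      simp only [revPathLaw, hR, mul_assoc]
    calc ∑ ω, revPathLaw S P' ω * (1 / (n : ℝ) * D (ω k.castSucc))
        = 1 / (n : ℝ) * ∑ ω, revPathLaw S P' ω * D (ω k.castSucc) := by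
          rw [mul_sum]; exact sum_congr rfl fun ω _ => by ring
      _ = 1 / (n : ℝ) * ∑ x, evolveLaw Q (gibbsLaw (S (Fin.last n))) (n - k) x * D x := by
          rw [hE1']
      _ = ∑ x, 1 / (n : ℝ) * (evolveLaw Q (gibbsLaw (S (Fin.last n))) (n - k) x * D x) := by
          rw [mul_sum]
  -- the reverse lag
  have hlagR : |∑ ω, revPathLaw S P' ω * work S ω
      - ∑ k ∈ range n, (1 / (n : ℝ)) * meanD S₀ D (((k + 1 : ℕ) : ℝ) / n)|
      ≤ θ / (1 - θ) * (σbar ^ 2 / n) := by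
    rw [hEW, ← sum_sub_distrib]
    refine (abs_sum_le_sum_abs _ _).trans ?_
    have hterm : ∀ k ∈ range n,
        |1 / (n : ℝ) * ∑ x, evolveLaw Q (gibbsLaw (S (Fin.last n))) (n - k) x * D x
          - 1 / (n : ℝ) * meanD S₀ D (((k + 1 : ℕ) : ℝ) / n)|
        ≤ 1 / (n : ℝ) * (θ / (1 - θ) * (σbar / n) * σbar) := by
      intro k hk
      have hk' : k < n := mem_range.mp hk
      rw [← mul_sub, abs_mul, abs_of_pos (by positivity : (0:ℝ) < 1 / n)]
      refine mul_le_mul_of_nonneg_left ?_ (by positivity)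
      have hgrid : revGrid n (n - k) = (((k + 1 : ℕ) : ℝ) / n) := by
        unfold revGrid; congr 2; omega
      have hmass : ∑ x, evolveLaw Q (gibbsLaw (S (Fin.last n))) (n - k) x = 1 := by
        rw [sum_evolveLaw Q hQrow, sum_gibbsLaw]
      have hcs := abs_sum_mul_sub_sum_mul_le (gibbsLaw_pos (linAction S₀ D (((k + 1 : ℕ) : ℝ) / n)))
        hmass (sum_gibbsLaw _) D
      have hc := hchi (n - k)
      rw [hgrid] at hc
      unfold meanD gibbsMean
      refine hcs.trans ?_
      rw [lawVariance_eq_varLaw (sum_gibbsLaw _)]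
      have hsq : Real.sqrt (varLaw (gibbsLaw (linAction S₀ D (((k + 1 : ℕ) : ℝ) / n))) D) ≤ σbar :=
        (Real.sqrt_le_sqrt (hσ _)).trans_eq (Real.sqrt_sq hσ0)
      exact mul_le_mul hc hsq (Real.sqrt_nonneg _) (by positivity)
    refine (sum_le_sum hterm).trans ?_
    rw [sum_const, card_range, nsmul_eq_mul]
    have : (n : ℝ) * (1 / (n : ℝ) * (θ / (1 - θ) * (σbar / n) * σbar))
        = θ / (1 - θ) * (σbar ^ 2 / n) := by field_simp
    rw [this]
  -- the quasi-static bookkeeping: KL = drop/n − KL_qs − lag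
  have hqs : qsDissipation S₀ D (fun k => (k : ℝ) / n) n
      = ∑ k ∈ range n, (1 / (n : ℝ)) * meanD S₀ D ((k : ℝ) / n)
        - (linFreeEnergy S₀ D (((n : ℕ) : ℝ) / n) - linFreeEnergy S₀ D (((0 : ℕ) : ℝ) / n)) := by
    unfold qsDissipation
    rw [sum_sub_distrib, Finset.sum_range_sub (fun k => linFreeEnergy S₀ D ((k : ℝ) / n)) n]
    congr 1
    refine sum_congr rfl fun k _ => ?_
    rw [succ_div_sub_div hn k]
  have hdrop := sum_drop_uniform S₀ D hn
  have hfloor := (abs_le.mp (abs_qsDissipation_uniform_sub_floor_le S₀ D hn hM)).2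
  have hKL := klFin_rev_eq S P' hst' hPpos'
  have hΔF : freeEnergy (S (Fin.last n)) - freeEnergy (S 0)
      = linFreeEnergy S₀ D (((n : ℕ) : ℝ) / n) - linFreeEnergy S₀ D (((0 : ℕ) : ℝ) / n) := by
    simp [hS, linFreeEnergy, Fin.val_last]
  -- KL ≥ drop/(2n) − M₃/(12n²) − lag budget
  have hKLge : (meanD S₀ D 0 - meanD S₀ D 1) / (2 * n)
        - θ / (1 - θ) * (σbar ^ 2 / n) - M₃ / (12 * (n : ℝ) ^ 2)
      ≤ klFin (revPathLaw S P') (pathLaw (gibbsLaw (S 0)) P') := by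
    rw [hKL, hΔF]
    have hsplit : ∑ k ∈ range n, (1 / (n : ℝ)) * meanD S₀ D ((k : ℝ) / n)
        - ∑ k ∈ range n, (1 / (n : ℝ)) * meanD S₀ D (((k + 1 : ℕ) : ℝ) / n)
        = (meanD S₀ D 0 - meanD S₀ D 1) / n := by
      rw [← sum_sub_distrib, ← hdrop, eq_div_iff hn'.ne', sum_mul]
      refine sum_congr rfl fun k _ => ?_
      field_simp
    have hl := (abs_le.mp hlagR).2
    have e2n : (meanD S₀ D 0 - meanD S₀ D 1) / n
        = 2 * ((meanD S₀ D 0 - meanD S₀ D 1) / (2 * n)) := by field_simp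
    linarith [hqs, hsplit, hfloor, hl, e2n]
  -- ESS ≤ exp(−KL)
  have hp : ∀ ω, 0 < revPathLaw S P' ω := revPathLaw_pos S hPpos'
  have hq : ∀ ω, 0 < pathLaw (gibbsLaw (S 0)) P' ω := fun ω => pathLaw_pos (gibbsLaw_pos _) hPpos' ω
  have hp1 : ∑ ω, revPathLaw S P' ω = 1 := sum_revPathLaw S P' hst'
  have hess := essFrac_le_exp_neg_kl hp hq hp1
  exact hess.trans (Real.exp_le_exp.mpr (by linarith))

/-- **Reversible irreducible positive layers**: the ESS ceiling with `ρ = max_k λ⋆(P_k)` and no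
other hypothesis (stationarity from detailed balance; the reversal of a reversible layer is the
layer; the contraction from Levin–Peres (12.8)). -/
theorem ess_path_uniform_le_exp_of_reversible [DecidableEq X] (S₀ D : X → ℝ)
    (P : ℕ → X → X → ℝ) {n : ℕ} (hn : n ≠ 0) {ΔD ρ σbar M₃ : ℝ} (hD : ∀ x y, |D x - D y| ≤ ΔD)
    (hP : ∀ k, IsRowStochastic (P k)) (hPpos : ∀ k x y, 0 < P k x y)
    (hDB : ∀ k, DetailedBalance (gibbsLaw (linAction S₀ D (((k + 1 : ℕ) : ℝ) / n))) (P k))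
    (hirr : ∀ k, IsIrreducible (P k)) (hlam : ∀ k, lambdaStar (P k) ≤ ρ)
    (hσ0 : 0 ≤ σbar) (hσ : ∀ c, varD S₀ D c ≤ σbar ^ 2)
    (hθ1 : ρ * Real.exp (ΔD / (2 * n)) < 1)
    (hM : ∀ c ∈ Set.Icc (0:ℝ) 1, |kappa3D S₀ D c| ≤ M₃) :
    essFrac (revPathLaw (fun k : Fin (n + 1) => linAction S₀ D ((k : ℝ) / n)) (fun k : Fin n => P k))
        (pathLaw (gibbsLaw (linAction S₀ D (((0 : Fin (n + 1)) : ℝ) / n))) (fun k : Fin n => P k))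
      ≤ Real.exp (-((meanD S₀ D 0 - meanD S₀ D 1) / (2 * n)
          - (ρ * Real.exp (ΔD / (2 * n))) / (1 - ρ * Real.exp (ΔD / (2 * n))) * (σbar ^ 2 / n)
          - M₃ / (12 * (n : ℝ) ^ 2))) := by
  have hρ : 0 ≤ ρ := (lambdaStar_nonneg (P 0)).trans (hlam 0)
  have hDBexp : ∀ k, DetailedBalance
      (fun x => Real.exp (-(linAction S₀ D (((k + 1 : ℕ) : ℝ) / n) x))) (P k) :=
    fun k => detailedBalance_exp_of_gibbsLaw (hDB k)
  refine ess_path_uniform_le_exp S₀ D P hn hD hPpos (fun k => (hDBexp k).isStationary (hP k).2)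
    (fun k => (hP k).2) (fun k => ?_) hρ hσ0 hσ hθ1 hM
  exact (chiSqContracts_of_reversible (gibbsLaw_pos _) (sum_gibbsLaw _) (hP k) (hDB k)
    (hirr k)).mono (fun x => (gibbsLaw_pos _ x).le) (lambdaStar_nonneg _) (hlam k)

end Ceiling


end Summit.Ventures.LatticeQCDFlow.Scaling
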